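import Summits.ValiantsHypothesis.ValiantsHypothesis.Theorems.DivisionGapPerDivisionHardWalkDefs

/-!
# Crux `DivisionGap.PerDivisionHard` (stmt-ValiantsHypothesis-5065), line `pair-descent-jss-endpoint` —
stub `stub_closedWalkSum_torus`: the closed walk sums are torus-homogeneous

Seat c8 of the line builds the WALK-SUM cofactor, whose factors are the closed walk sums
`closedWalkSum n L R₀ ρ₀ a₀ = Σ_{closed NB walks} x^{walkExponent}`.  This file certifies that every
closed walk sum is TORUS-HOMOGENEOUS (`IsTorusHomogeneous`: all its monomials share one vector of row
margins and one vector of column margins).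

Proof.  Every monomial of the sum is one of the exponents `walkExponent ρ₀ a₀ rows cols`
(`MvPolynomial.support_sum`, `MvPolynomial.support_monomial_subset`).  Row margins
(`rowDegrees = Finsupp.mapDomain Prod.fst`) and column margins (`Finsupp.mapDomain Prod.snd`) are
additive, so the margins of `walkExponent = Σ_t walkStep …` are the sums of the margins of the `L`
steps; by `walkStep_margins` every step has the SAME row margins `r₀ = (3,…,3n at ρ₀,…,3)` and column
margins `c₀ = (3,…,3n at a₀,…,3)`, whence every monomial has row margins `L • r₀` and column margins
`L • c₀`.  The empty sum (no closed walks) has no monomials and is torus-homogeneous vacuously.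
[folklore]
-/

noncomputable section

-- `Summit.ValiantsHypothesis.ValiantsHypothesis.…` is the tree's mandated single-conjunct layout
-- (Sub = Summit), so the duplicated namespace component is intended.
set_option linter.dupNamespace false

namespace Summit.ValiantsHypothesis.ValiantsHypothesis.Theorems.DivisionGapPerDivisionHard

open MvPolynomial Literature.Computability.AlgebraicComplexity
open scoped NNReal BigOperators

/-- The row margins of a walk step are the fixed vector `(3,…,3n at ρ₀,…,3)`, whatever the step
`(R, Cᵢₙ, Cₒᵤₜ)` is (`walkStep_margins`, first component, as an equality of finsupps). [folklore] -/
theorem rowDegrees_walkStep {n : ℕ} (ρ₀ a₀ R Cin Cout : Fin n) :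
    rowDegrees (walkStep ρ₀ a₀ R Cin Cout) =
      Finsupp.equivFunOnFinite.symm (fun r : Fin n => if r = ρ₀ then 3 * n else 3) := by
  ext r
  rw [Finsupp.coe_equivFunOnFinite_symm]
  exact (walkStep_margins n ρ₀ a₀ R Cin Cout).1 r

/-- The column margins of a walk step are the fixed vector `(3,…,3n at a₀,…,3)`, whatever the step
`(R, Cᵢₙ, Cₒᵤₜ)` is (`walkStep_margins`, second component, as an equality of finsupps). [folklore] -/
theorem colDegrees_walkStep {n : ℕ} (ρ₀ a₀ R Cin Cout : Fin n) :
    Finsupp.mapDomain Prod.snd (walkStep ρ₀ a₀ R Cin Cout) =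
      Finsupp.equivFunOnFinite.symm (fun c : Fin n => if c = a₀ then 3 * n else 3) := by
  ext c
  rw [Finsupp.coe_equivFunOnFinite_symm]
  exact (walkStep_margins n ρ₀ a₀ R Cin Cout).2 c

/-- The row margins of the exponent of a walk of length `L` are `L • (3,…,3n at ρ₀,…,3)`: row margins
are additive and every one of the `L` steps contributes the same vector. [folklore] -/
theorem rowDegrees_walkExponent {n L : ℕ} (ρ₀ a₀ : Fin n) (rows : Fin L → Fin n)
    (cols : Fin (L + 1) → Fin n) :
    rowDegrees (walkExponent ρ₀ a₀ rows cols) =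
      L • Finsupp.equivFunOnFinite.symm (fun r : Fin n => if r = ρ₀ then 3 * n else 3) := by
  unfold walkExponent rowDegrees
  rw [Finsupp.mapDomain_finsetSum]
  change ∑ t : Fin L, rowDegrees (walkStep ρ₀ a₀ (rows t) (cols t.castSucc) (cols t.succ)) = _
  simp only [rowDegrees_walkStep, Finset.sum_const, Finset.card_univ, Fintype.card_fin]

/-- The column margins of the exponent of a walk of length `L` are `L • (3,…,3n at a₀,…,3)`: column
margins are additive and every one of the `L` steps contributes the same vector. [folklore] -/
theorem colDegrees_walkExponent {n L : ℕ} (ρ₀ a₀ : Fin n) (rows : Fin L → Fin n)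
    (cols : Fin (L + 1) → Fin n) :
    Finsupp.mapDomain Prod.snd (walkExponent ρ₀ a₀ rows cols) =
      L • Finsupp.equivFunOnFinite.symm (fun c : Fin n => if c = a₀ then 3 * n else 3) := by
  unfold walkExponent
  rw [Finsupp.mapDomain_finsetSum]
  simp only [colDegrees_walkStep, Finset.sum_const, Finset.card_univ, Fintype.card_fin]

/-- Every monomial of the closed walk sum `closedWalkSum n L R₀ ρ₀ a₀` is the exponent
`walkExponent ρ₀ a₀ rows cols` of some closed non-backtracking walk `(rows, cols)` of length `L` based
at `R₀` (the support of a sum of monomials is contained in the set of their exponents). [folklore] -/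
theorem exists_walk_of_mem_support_closedWalkSum {n L : ℕ} (R₀ ρ₀ a₀ : Fin n)
    {m : (Fin n × Fin n) →₀ ℕ} (hm : m ∈ (closedWalkSum n L R₀ ρ₀ a₀).support) :
    ∃ (rows : Fin L → Fin n) (cols : Fin (L + 1) → Fin n),
      IsClosedNBWalk L R₀ rows cols ∧ m = walkExponent ρ₀ a₀ rows cols := by
  classical
  unfold closedWalkSum at hm
  obtain ⟨p, hp, hmp⟩ := Finset.mem_biUnion.1 (MvPolynomial.support_sum hm)
  exact ⟨p.1, p.2, (Finset.mem_filter.1 hp).2,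
    Finset.mem_singleton.1 (MvPolynomial.support_monomial_subset hmp)⟩

/-- **stub_closedWalkSum_torus — the closed walk sums are torus-homogeneous.**  Every monomial of
`closedWalkSum n L R₀ ρ₀ a₀` has row margins `L • (3,…,3n at ρ₀,…,3)` and column margins
`L • (3,…,3n at a₀,…,3)`: it is a `walkExponent`, the sum of `L` walk steps, and every walk step has
the same margins (`walkStep_margins`). [folklore] -/
theorem stub_closedWalkSum_torus :
    ∀ (n L : ℕ) (R₀ ρ₀ a₀ : Fin n), IsTorusHomogeneous (closedWalkSum n L R₀ ρ₀ a₀) := by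
  intro n L R₀ ρ₀ a₀
  refine ⟨L • Finsupp.equivFunOnFinite.symm (fun r : Fin n => if r = ρ₀ then 3 * n else 3),
    L • Finsupp.equivFunOnFinite.symm (fun c : Fin n => if c = a₀ then 3 * n else 3), fun m hm => ?_⟩
  obtain ⟨rows, cols, -, rfl⟩ := exists_walk_of_mem_support_closedWalkSum R₀ ρ₀ a₀ hm
  exact ⟨rowDegrees_walkExponent ρ₀ a₀ rows cols, colDegrees_walkExponent ρ₀ a₀ rows cols⟩

end Summit.ValiantsHypothesis.ValiantsHypothesis.Theorems.DivisionGapPerDivisionHard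

end
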